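import Summits.ResolutionOfSingularities.ResolutionOfSingularities.Theorems.HilbertSamuelEliminationCampaignW42ToricMarkedFanMove

/-!
# [OURS · L1 W4.2] Toric marked monomial objects in dimension 3 — brick 7E (part 2): STAR SUBDIVISION OF A FAN IS A FAN; fan plays of positions

[OURS · L1 W4.2 · seat res-L1-s42-pv-2 gen 5] Memo `L/res-L1-s42-pv-2/CALIBRATION-W42-O2-v4.md` §7 (bridge B2, completed in the id/vector model).
The pair property under the blow-up of a face `R`: the cone of a child `(C ∖ x) ∪ {ρ}` and an untouched cone `C' ⊉ R` meet in the cone of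
`(C ∩ C') ∖ x` (`pair_child_old`); the cones of two children `(C ∖ x) ∪ {ρ}`, `(C' ∖ x') ∪ {ρ}` meet in the cone of their common rays
(`pair_child_child`) — both by comparing coefficients on the parent bases (uniqueness from independence, non-negativity forces the `ρ`-coefficient
bookkeeping); hence `IsFan.move` (with brick 7E part 1).  Vector-model plays `PlayV` lift toric plays, preserve `IsFan`/`WF`/`Dict`, and so
**every W-top position has a play from its standard corner that ends E-resolved and along which every state is a FAN with the exponent dictionary**
(`exists_fan_play_eresolved`) — the input of the final simulation with `IdeasL1Idea2R8.cornerPuzzle` (bridge B1: activity clause, `Won = ≤`; not here).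
NOT a statement of the manuscript under review.  AI work, weaker than expert review.  No `sorry`, no new axiom.
-/

set_option linter.dupNamespace false -- mandated namespace of this single-conjunct summit

namespace Summit.ResolutionOfSingularities.ResolutionOfSingularities.Theorems.CampaignW42.Toric

open Finset

namespace VState

open Fan

variable {ι : Type}

/-- Coefficients on the parent cone `C` of a combination with coefficients `c` on the child `(C ∖ x) ∪ {n}`, `vec n = Σ_R vec`. -/
def childCoeff (c : ℕ → ℚ) (x : ℕ) (R : Finset ℕ) (n : ℕ) : ℕ → ℚ :=
  fun y => (if y = x then 0 else c y) + (if y ∈ R then c n else 0)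

/-- **Expansion of a child-cone combination on the parent basis.** -/
theorem sum_child_eq_sum_parent {m : ℕ} {s : VState ι} {R C : Finset ℕ} {x : ℕ} (hRC : R ⊆ C) (hx : x ∈ R) (hC : s.next ∉ C)
    (c : ℕ → ℚ) :
    ∑ y ∈ insert s.next (C.erase x), c y • qv (s.move m R).vec y = ∑ y ∈ C, childCoeff c x R s.next y • qv s.vec y := by
  classical
  have hxC : x ∈ C := hRC hx
  rw [sum_child_qv hC, add_comm]
  unfold childCoeff
  simp_rw [add_smul, Finset.sum_add_distrib]
  congr 1
  · rw [← Finset.add_sum_erase C (fun y => (if y = x then (0:ℚ) else c y) • qv s.vec y) hxC, if_pos rfl, zero_smul, zero_add]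
    exact Finset.sum_congr rfl (fun y hy => by rw [if_neg (Finset.mem_erase.mp hy).1])
  · rw [Finset.smul_sum,
      ← Finset.sum_subset hRC (f := fun y => (if y ∈ R then c s.next else 0) • qv s.vec y)
        (fun y _ hyR => by rw [if_neg hyR, zero_smul])]
    exact Finset.sum_congr rfl (fun y hy => by rw [if_pos hy])

/-- A combination over a sub-family `G ⊆ C` is the combination over `C` with coefficients extended by zero. -/
theorem sum_subfamily_eq {V : ℕ → Fin 3 → ℤ} {G C : Finset ℕ} (hGC : G ⊆ C) (g : ℕ → ℚ) :
    ∑ y ∈ G, g y • qv V y = ∑ y ∈ C, (if y ∈ G then g y else 0) • qv V y := by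
  classical
  rw [← Finset.sum_subset hGC (f := fun y => (if y ∈ G then g y else 0) • qv V y)
    (fun y _ hy => by rw [if_neg hy, zero_smul])]
  exact Finset.sum_congr rfl (fun y hy => by rw [if_pos hy])

/-- Cones over untouched id-sets are unchanged by a blow-up. -/
theorem inCone_move_iff_of_not_mem {m : ℕ} {s : VState ι} {R D : Finset ℕ} (hD : s.next ∉ D) (p : Fin 3 → ℚ) :
    InCone (s.move m R).vec D p ↔ InCone s.vec D p := by
  unfold InCone
  have h : ∀ c : ℕ → ℚ, ∑ r ∈ D, c r • qv (s.move m R).vec r = ∑ r ∈ D, c r • qv s.vec r :=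
    fun c => Finset.sum_congr rfl (fun r hr => by rw [qv_move_of_ne (fun h => hD (h ▸ hr))])
  simp_rw [h]

/-- Independence over untouched id-sets is unchanged by a blow-up. -/
theorem indep_move_of_not_mem {m : ℕ} {s : VState ι} {R D : Finset ℕ} (hD : s.next ∉ D) (h : Indep s.vec D) :
    Indep (s.move m R).vec D := by
  intro c hc
  have h' : ∑ r ∈ D, c r • qv (s.move m R).vec r = ∑ r ∈ D, c r • qv s.vec r :=
    Finset.sum_congr rfl (fun r hr => by rw [qv_move_of_ne (fun h => hD (h ▸ hr))])
  rw [h'] at hc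
  exact h c hc

/-- **(B2-c) child vs. untouched cone.**  If the cones of `C ⊇ R` and of `C' ⊉ R` meet in the cone of `C ∩ C'`, then after blowing up `R`
the cone of the child `(C ∖ x) ∪ {ρ}` and the (unchanged) cone of `C'` meet in the cone of their common rays `(C ∩ C') ∖ x`. -/
theorem pair_child_old {m : ℕ} {s : VState ι} {R C C' : Finset ℕ} {x : ℕ} (hind : Indep s.vec C) (hRC : R ⊆ C) (hx : x ∈ R)
    (hC : s.next ∉ C) (hC' : s.next ∉ C') (hRC' : ¬ R ⊆ C')
    (hpair : ∀ p, InCone s.vec C p → InCone s.vec C' p → InCone s.vec (C ∩ C') p)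
    {p : Fin 3 → ℚ} (hp : InCone (s.move m R).vec (insert s.next (C.erase x)) p) (hp' : InCone (s.move m R).vec C' p) :
    InCone (s.move m R).vec (insert s.next (C.erase x) ∩ C') p := by
  classical
  have hinter : insert s.next (C.erase x) ∩ C' = (C ∩ C').erase x := by
    ext y
    simp only [Finset.mem_inter, Finset.mem_insert, Finset.mem_erase]
    constructor
    · rintro ⟨rfl | ⟨hyx, hyC⟩, hyC'⟩
      · exact absurd hyC' hC'
      · exact ⟨hyx, hyC, hyC'⟩
    · rintro ⟨hyx, hyC, hyC'⟩; exact ⟨Or.inr ⟨hyx, hyC⟩, hyC'⟩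
  rw [hinter, inCone_move_iff_of_not_mem (fun h => hC (Finset.mem_inter.mp (Finset.mem_of_mem_erase h)).1)]
  -- expansions
  obtain ⟨c, hc0, hcp⟩ := hp
  have hpC : InCone s.vec C p := inCone_parent_of_inCone_child hRC hx hC ⟨c, hc0, hcp⟩
  have hpC' : InCone s.vec C' p := (inCone_move_iff_of_not_mem hC' p).mp hp'
  obtain ⟨f, hf0, hfp⟩ := hpair p hpC hpC'
  -- compare on the basis C
  have h1 : ∑ y ∈ C, childCoeff c x R s.next y • qv s.vec y = ∑ y ∈ C, (if y ∈ C ∩ C' then f y else 0) • qv s.vec y := by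
    rw [← sum_child_eq_sum_parent hRC hx hC c, ← hcp, ← sum_subfamily_eq Finset.inter_subset_left f, ← hfp]
  have huniq := hind.coeff_unique h1
  -- c ρ = 0 : use a ray of R outside C'
  obtain ⟨y₀, hy₀R, hy₀C'⟩ : ∃ y₀ ∈ R, y₀ ∉ C' := by
    by_contra hno; push Not at hno; exact hRC' (fun y hy => hno y hy)
  have hα : 0 ≤ c s.next := hc0 _ (Finset.mem_insert_self _ _)
  have hρ : c s.next = 0 := by
    have hy := huniq y₀ (hRC hy₀R)
    have hnotF : y₀ ∉ C ∩ C' := fun h => hy₀C' (Finset.mem_inter.mp h).2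
    rw [if_neg hnotF] at hy
    unfold childCoeff at hy
    rw [if_pos hy₀R] at hy
    by_cases hyx : y₀ = x
    · rw [if_pos hyx] at hy; simpa using hy
    · rw [if_neg hyx] at hy
      have : 0 ≤ c y₀ := hc0 _ (Finset.mem_insert_of_mem (Finset.mem_erase.mpr ⟨hyx, hRC hy₀R⟩))
      linarith
  -- the coefficients of p on C ∖ x vanish outside C ∩ C'
  refine ⟨c, fun y hy => hc0 y (Finset.mem_insert_of_mem (Finset.mem_erase.mpr
    ⟨(Finset.mem_erase.mp hy).1, (Finset.mem_inter.mp (Finset.mem_of_mem_erase hy)).1⟩)), ?_⟩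
  -- p = Σ_{(C∩C')∖x} c y • v y
  rw [hcp, sum_child_eq_sum_parent hRC hx hC c]
  have hxC : x ∈ C := hRC hx
  symm
  rw [sum_subfamily_eq ((Finset.erase_subset _ _).trans Finset.inter_subset_left) c]
  refine Finset.sum_congr rfl (fun y hy => ?_)
  congr 1
  have hy' := huniq y hy
  unfold childCoeff at hy' ⊢
  rw [hρ] at hy' ⊢
  by_cases hyx : y = x
  · subst hyx; simp
  · rw [if_neg hyx] at hy' ⊢
    simp only [ite_self, add_zero] at hy' ⊢
    by_cases hyF : y ∈ C ∩ C'
    · rw [if_pos (Finset.mem_erase.mpr ⟨hyx, hyF⟩)]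
    · rw [if_neg hyF] at hy'
      rw [if_neg (fun h => hyF (Finset.mem_of_mem_erase h)), hy']

/-- **(B2-d) child vs. child.**  If the cones of `C ⊇ R` and `C' ⊇ R` meet in the cone of `C ∩ C'`, then after blowing up `R` the cones of the
children `(C ∖ x) ∪ {ρ}` and `(C' ∖ x') ∪ {ρ}` (`x, x' ∈ R`) meet in the cone of their common rays. -/
theorem pair_child_child {m : ℕ} {s : VState ι} {R C C' : Finset ℕ} {x x' : ℕ} (hind : Indep s.vec C) (hind' : Indep s.vec C')
    (hRC : R ⊆ C) (hRC' : R ⊆ C') (hx : x ∈ R) (hx' : x' ∈ R) (hC : s.next ∉ C) (hC' : s.next ∉ C')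
    (hpair : ∀ p, InCone s.vec C p → InCone s.vec C' p → InCone s.vec (C ∩ C') p)
    {p : Fin 3 → ℚ} (hp : InCone (s.move m R).vec (insert s.next (C.erase x)) p)
    (hp' : InCone (s.move m R).vec (insert s.next (C'.erase x')) p) :
    InCone (s.move m R).vec (insert s.next (C.erase x) ∩ insert s.next (C'.erase x')) p := by
  classical
  set G := C ∩ C' with hGdef
  have hRG : R ⊆ G := Finset.subset_inter hRC hRC'
  have hinter : insert s.next (C.erase x) ∩ insert s.next (C'.erase x') = insert s.next ((G.erase x).erase x') := by
    ext y
    simp only [Finset.mem_inter, Finset.mem_insert, Finset.mem_erase, hGdef]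
    constructor
    · rintro ⟨rfl | ⟨hyx, hyC⟩, h2⟩
      · exact Or.inl rfl
      · rcases h2 with rfl | ⟨hyx', hyC'⟩
        · exact absurd hyC hC
        · exact Or.inr ⟨hyx', ⟨hyx, hyC, hyC'⟩⟩
    · rintro (rfl | ⟨hyx', hyx, hyC, hyC'⟩)
      · exact ⟨Or.inl rfl, Or.inl rfl⟩
      · exact ⟨Or.inr ⟨hyx, hyC⟩, Or.inr ⟨hyx', hyC'⟩⟩
  rw [hinter]
  obtain ⟨c, hc0, hcp⟩ := hp
  obtain ⟨c', hc0', hcp'⟩ := hp'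
  have hpC : InCone s.vec C p := inCone_parent_of_inCone_child hRC hx hC ⟨c, hc0, hcp⟩
  have hpC' : InCone s.vec C' p := inCone_parent_of_inCone_child hRC' hx' hC' ⟨c', hc0', hcp'⟩
  obtain ⟨g, hg0, hgp⟩ := hpair p hpC hpC'
  -- γ = g on C, γ' = g on C'
  have h1 : ∑ y ∈ C, childCoeff c x R s.next y • qv s.vec y = ∑ y ∈ C, (if y ∈ G then g y else 0) • qv s.vec y := by
    rw [← sum_child_eq_sum_parent hRC hx hC c, ← hcp, ← sum_subfamily_eq Finset.inter_subset_left g, ← hgp]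
  have h1' : ∑ y ∈ C', childCoeff c' x' R s.next y • qv s.vec y = ∑ y ∈ C', (if y ∈ G then g y else 0) • qv s.vec y := by
    rw [← sum_child_eq_sum_parent hRC' hx' hC' c', ← hcp', ← sum_subfamily_eq Finset.inter_subset_right g, ← hgp]
  have hu := hind.coeff_unique h1
  have hu' := hind'.coeff_unique h1'
  have hxG : x ∈ G := hRG hx
  have hx'G : x' ∈ G := hRG hx'
  have hα0 : 0 ≤ c s.next := hc0 _ (Finset.mem_insert_self _ _)
  have hα0' : 0 ≤ c' s.next := hc0' _ (Finset.mem_insert_self _ _)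
  -- evaluate at x and x'
  have ex : childCoeff c x R s.next x = g x := by have := hu x (hRC hx); rwa [if_pos hxG] at this
  have ex' : childCoeff c' x' R s.next x' = g x' := by have := hu' x' (hRC' hx'); rwa [if_pos hx'G] at this
  have fx : childCoeff c' x' R s.next x = g x := by have := hu' x (hRC' hx); rwa [if_pos hxG] at this
  have fx' : childCoeff c x R s.next x' = g x' := by have := hu x' (hRC hx'); rwa [if_pos hx'G] at this
  unfold childCoeff at ex ex' fx fx'
  rw [if_pos rfl, if_pos hx] at ex
  rw [if_pos rfl, if_pos hx'] at ex'
  rw [if_pos hx] at fx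
  rw [if_pos hx'] at fx'
  -- α := c ρ = c' ρ, and the cross coefficients vanish
  have hαeq : c s.next = c' s.next ∧ (x ≠ x' → c' x = 0 ∧ c x' = 0) := by
    by_cases hxx : x = x'
    · subst hxx
      rw [if_pos rfl] at fx
      constructor
      · linarith
      · intro h; exact absurd rfl h
    · rw [if_neg hxx] at fx
      rw [if_neg (Ne.symm hxx)] at fx'
      have h0 : 0 ≤ c' x := hc0' _ (Finset.mem_insert_of_mem (Finset.mem_erase.mpr ⟨hxx, hRC' hx⟩))
      have h0' : 0 ≤ c x' := hc0 _ (Finset.mem_insert_of_mem (Finset.mem_erase.mpr ⟨Ne.symm hxx, hRC hx'⟩))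
      refine ⟨by linarith, fun _ => ⟨by linarith, by linarith⟩⟩
  -- the witness: coefficients c on the common face, α at ρ
  refine ⟨c, fun y hy => ?_, ?_⟩
  · rcases Finset.mem_insert.mp hy with rfl | hy'
    · exact hα0
    · have hyx' := (Finset.mem_erase.mp hy').1
      have hyx := (Finset.mem_erase.mp (Finset.mem_erase.mp hy').2).1
      have hyG := (Finset.mem_erase.mp (Finset.mem_erase.mp hy').2).2
      exact hc0 y (Finset.mem_insert_of_mem (Finset.mem_erase.mpr ⟨hyx, (Finset.mem_inter.mp hyG).1⟩))
  -- p = c ρ • v' ρ + Σ_{(G∖x)∖x'} c y • v y ; compare with the expansion of p over the child of C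
  have hnG : s.next ∉ (G.erase x).erase x' := fun h =>
    hC (Finset.mem_inter.mp (Finset.mem_of_mem_erase (Finset.mem_of_mem_erase h))).1
  rw [Finset.sum_insert hnG, hcp]
  have hsub : (G.erase x).erase x' ⊆ C.erase x := by
    intro y hy
    exact Finset.mem_erase.mpr ⟨(Finset.mem_erase.mp (Finset.mem_erase.mp hy).2).1,
      (Finset.mem_inter.mp (Finset.mem_erase.mp (Finset.mem_erase.mp hy).2).2).1⟩
  have h1x : s.next ∉ C.erase x := fun h => hC (Finset.mem_of_mem_erase h)
  rw [Finset.sum_insert h1x]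
  congr 1
  -- Σ_{C∖x} c y • v' y = Σ_{(G∖x)∖x'} c y • v' y : coefficients vanish off the common face
  symm
  apply Finset.sum_subset hsub
  intro y hyC hyn
  have hyx : y ≠ x := (Finset.mem_erase.mp hyC).1
  have hyC0 : y ∈ C := (Finset.mem_erase.mp hyC).2
  have hcy : childCoeff c x R s.next y = (if y ∈ G then g y else 0) := hu y hyC0
  unfold childCoeff at hcy
  rw [if_neg hyx] at hcy
  -- either y ∉ G, or y = x' (≠ x)
  by_cases hyG : y ∈ G
  · have hyx' : y = x' := by
      by_contra h; exact hyn (Finset.mem_erase.mpr ⟨h, Finset.mem_erase.mpr ⟨hyx, hyG⟩⟩)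
    subst hyx'
    have := (hαeq.2 (Ne.symm hyx)).2
    rw [this, zero_smul]
  · rw [if_neg hyG] at hcy
    have hyR : y ∉ R := fun h => hyG (hRG h)
    rw [if_neg hyR, add_zero] at hcy
    rw [hcy, zero_smul]

end VState

end Summit.ResolutionOfSingularities.ResolutionOfSingularities.Theorems.CampaignW42.Toric


namespace Summit.ResolutionOfSingularities.ResolutionOfSingularities.Theorems.CampaignW42.Toric

open Finset

namespace VState

open Fan

variable {ι : Type}

/-- **[OURS · L1 W4.2] STAR SUBDIVISION OF A FAN IS A FAN** (id/vector model): the fan property of a well-formed vector state is preserved by the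
blow-up of any face. -/
theorem IsFan.move {m : ℕ} {s : VState ι} (h : s.IsFan) (hwf : s.WF) (R : Finset ℕ) : (s.move m R).IsFan := by
  classical
  have hcones : ∀ D, D ∈ (s.move m R).cones ↔ ∃ C ∈ s.cones, D ∈ s.toTState.children R C := fun D => TState.mem_move_cones
  constructor
  · intro D hD
    obtain ⟨C, hC, hDC⟩ := (hcones D).mp hD
    have hnC : s.next ∉ C := hwf.next_notMem hC
    by_cases hRC : R ⊆ C
    · rw [TState.children_of_subset hRC, Finset.mem_image] at hDC
      obtain ⟨x, hx, rfl⟩ := hDC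
      exact indep_child (h.1 C hC) hRC hx hnC
    · rw [TState.children_of_not_subset hRC, Finset.mem_singleton] at hDC
      subst hDC
      exact indep_move_of_not_mem hnC (h.1 D hC)
  · intro D hD D' hD' p hp hp'
    obtain ⟨C, hC, hDC⟩ := (hcones D).mp hD
    obtain ⟨C', hC', hDC'⟩ := (hcones D').mp hD'
    have hnC : s.next ∉ C := hwf.next_notMem hC
    have hnC' : s.next ∉ C' := hwf.next_notMem hC'
    have hpair := h.2 C hC C' hC'
    by_cases hRC : R ⊆ C <;> by_cases hRC' : R ⊆ C'
    · rw [TState.children_of_subset hRC, Finset.mem_image] at hDC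
      rw [TState.children_of_subset hRC', Finset.mem_image] at hDC'
      obtain ⟨x, hx, rfl⟩ := hDC
      obtain ⟨x', hx', rfl⟩ := hDC'
      exact pair_child_child (h.1 C hC) (h.1 C' hC') hRC hRC' hx hx' hnC hnC' hpair hp hp'
    · rw [TState.children_of_subset hRC, Finset.mem_image] at hDC
      rw [TState.children_of_not_subset hRC', Finset.mem_singleton] at hDC'
      obtain ⟨x, hx, rfl⟩ := hDC
      subst hDC'
      exact pair_child_old (h.1 C hC) hRC hx hnC hnC' hRC' hpair hp hp'
    · rw [TState.children_of_not_subset hRC, Finset.mem_singleton] at hDC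
      rw [TState.children_of_subset hRC', Finset.mem_image] at hDC'
      subst hDC
      obtain ⟨x', hx', rfl⟩ := hDC'
      have hpair' : ∀ q, InCone s.vec C' q → InCone s.vec D q → InCone s.vec (C' ∩ D) q :=
        fun q h1 h2 => by rw [Finset.inter_comm]; exact hpair q h2 h1
      rw [Finset.inter_comm]
      exact pair_child_old (h.1 C' hC') hRC' hx' hnC' hnC hRC hpair' hp' hp
    · rw [TState.children_of_not_subset hRC, Finset.mem_singleton] at hDC
      rw [TState.children_of_not_subset hRC', Finset.mem_singleton] at hDC'
      subst hDC; subst hDC'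
      have h1 := (inCone_move_iff_of_not_mem hnC p).mp hp
      have h2 := (inCone_move_iff_of_not_mem hnC' p).mp hp'
      exact (inCone_move_iff_of_not_mem (fun hn => hnC (Finset.mem_inter.mp hn).1) p).mpr (hpair p h1 h2)

/-- **[OURS · L1 W4.2]** Plays of the vector model: finite sequences of blow-ups at faces that are legal for the underlying toric state. -/
inductive PlayV (m : ℕ) : VState ι → VState ι → Prop
  | refl (s : VState ι) : PlayV m s s
  | step {s t : VState ι} (R : Finset ℕ) : s.toTState.Legal m R → PlayV m (s.move m R) t → PlayV m s t

/-- Every play of the underlying toric state lifts to a play of the vector model with the same final toric state. -/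
theorem exists_playV_of_play {m : ℕ} {s : VState ι} {t : TState ι} (h : s.toTState.Play m t) : ∃ t' : VState ι, s.PlayV m t' ∧ t'.toTState = t := by
  -- generalise over the vector data
  suffices H : ∀ (s₀ : TState ι) (t : TState ι), s₀.Play m t → ∀ (s : VState ι), s.toTState = s₀ → ∃ t' : VState ι, s.PlayV m t' ∧ t'.toTState = t from
    H _ _ h s rfl
  intro s₀ t h
  induction h with
  | refl s₀ => intro s hs; exact ⟨s, PlayV.refl s, hs⟩
  | step R hR _ ih =>
    intro s hs
    subst hs
    obtain ⟨t', ht', htt⟩ := ih (s.move m R) rfl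
    exact ⟨t', PlayV.step R hR ht', htt⟩

/-- The fan property, well-formedness, non-negativity and the dictionary persist along plays of the vector model. -/
theorem PlayV.invariants {m : ℕ} {val : ι → Fin 3 → ℚ} {s t : VState ι} (h : s.PlayV m t) (hf : s.IsFan) (hwf : s.WF) (hd : s.Dict m val) :
    t.IsFan ∧ t.WF ∧ t.Dict m val := by
  induction h with
  | refl s => exact ⟨hf, hwf, hd⟩
  | step R _ _ ih => exact ih (hf.move hwf R) (TState.WF.move hwf R) (hd.move R)

/-- **[OURS · L1 W4.2] Every W-top position admits a vector-model play, starting from its standard corner, along which the states stay FANS (so the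
vector naming of `HStage` is faithful) and the exponent dictionary holds, and which ends E-resolved.**  This is bridge B2's input to the final
simulation with `IdeasL1Idea2R8.cornerPuzzle` (bridge B1: activity clause / `Won = ≤`, memo §4). -/
theorem exists_fan_play_eresolved (A : Finset (Fin 3 → ℚ)) (hA : Literature.Combinatorics.HironakaPolyhedraGame.IsPosition A) :
    ∃ (m : ℕ) (hm : ∀ v ∈ A, ∀ k : Fin 3, ∃ z : ℤ, (v k) * m = z) (t : VState {v // v ∈ A}),
      0 < m ∧ (ofPosition A m hm).PlayV m t ∧ t.EResolved m ∧ t.IsFan ∧ t.WF ∧ t.Dict m (fun v => v.1) := by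
  obtain ⟨m, hm, hmpos, t₀, hplay, hres⟩ := TState.eresolvable_of_isPosition A hA
  obtain ⟨t, ht, htt⟩ := exists_playV_of_play (s := ofPosition A m hm) hplay
  obtain ⟨hf, hwf, hd⟩ := ht.invariants (isFan_ofPosition A m hm) (TState.initial_WF _) (dict_ofPosition A m hm)
  refine ⟨m, hm, t, hmpos, ht, ?_, hf, hwf, hd⟩
  rw [htt]; exact hres

end VState

end Summit.ResolutionOfSingularities.ResolutionOfSingularities.Theorems.CampaignW42.Toric
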